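import Literature.NumberTheory.EllipticCurves.DeShalit1987.KatzDistributionFromLMeasure
import Literature.NumberTheory.GaloisRepresentations.WeilLAdicCharacterProofs
import HarnessLib

/-!
# de Shalit 1987, II.4.16 (49)–(50) on the Galois group ⟹ `IsKatzDistribution₂` for EVERY ALGEBRAIC twist
# (Weil's avatar supplied) — proofs only

Companion of `DeShalit1987/KatzDistributionFromLMeasure.lean` (the predicate `DeShalit1987.IsLMeasure`:
de Shalit's (49)–(50) for a bounded distribution on `Γ_K` along a tower of open subgroups, and the
derivation `IsLMeasure.isKatzDistribution₂` for a twist `λ` WITH A GIVEN AVATAR). Here the avatar is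
SUPPLIED for every algebraic `λ` by Weil's theorem, PROVED in the tree
(`HeckeCharacter.IsAlgebraic.exists_lAdic`, `WeilLAdicCharacterProofs.lean`), so that the
measure-currency statement implies the avatar-free distribution-currency statement of
`thmII417_exists_katzSheet_iff_exists_katzDistribution₂` (hypothesis `hμ` of the `bsd-print-cf2` crux
files at `p = 2`):

* `DeShalit1987.exists_isKatzDistribution₂_of_isLMeasure_of_isAlgebraic`;
* `DeShalit1987.katzDistributions₂_of_lMeasures` (fixed prime, all `K, ι, v, v̄, S, λ, κ₁, κ₂`).

THEOREMS ONLY (no definition, no named fact, no `sorry`, no instance).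

## References

* [deShalit1987] E. de Shalit, *Iwasawa theory of elliptic curves with complex multiplication* (1987):
  II Thm. 4.14 (36) (p. 71), II.4.16 (49)–(50) (p. 76–77), II.4.17 (54) (p. 78).
* [Weil1956] A. Weil, *On a certain type of characters of the idèle-class group of an algebraic
  number-field* (1956), §1–§2.
-/

noncomputable section

open scoped Classical
open Filter Polynomial
open NumberField IsDedekindDomain Field
open Literature.NumberTheory.GaloisRepresentations

namespace Literature.NumberTheory.EllipticCurves

/-! ### The measure gives `IsKatzDistribution₂` for every ALGEBRAIC twist -/

variable {p : ℕ} [Fact p.Prime]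

/-- **The measure for the modulus `S` gives de Shalit's integrals on the `ℤ_p²`-quotient for EVERY
ALGEBRAIC twist**: if `μ` on `Γ_K` along `𝒰` (open, `⋂ U_n ⊆ Gal(K̄/K(𝔣p^∞))`, `‖μ‖ ≤ 1`) satisfies
`IsLMeasure ι v v̄ S Ω δ Ω_p`, then for every algebraic Hecke character `λ` unramified outside
`S ∪ {v, v̄}` and every independent pair `(κ₁, κ₂)` there is a bounded distribution `D` on `ℤ_p²` of
norm `≤ 1` with `IsKatzDistribution₂ ι v v̄ S κ₁ κ₂ λ Ω δ Ω_p D` — the avatar `l = λ̂_{dS}⁻¹` exists by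
Weil's theorem (`HeckeCharacter.IsAlgebraic.exists_lAdic`, proved in the tree) and
`D = π_*(l·μ)` (`IsLMeasure.exists_isKatzDistribution₂`).
[cite: deShalit1987, II.4.16 (49)–(50) (p. 76–77), II.4.17 (54) (p. 78)] [cite: Weil1956, §1–§2] -/
theorem DeShalit1987.exists_isKatzDistribution₂_of_isLMeasure_of_isAlgebraic {K : Type} [Field K]
    [NumberField K] {ι : PadicAlgCl p ≃+* ℂ} {v vbar : HeightOneSpectrum (𝓞 K)}
    (hv : ((p : ℕ) : 𝓞 K) ∈ v.asIdeal) (hvbar : ((p : ℕ) : 𝓞 K) ∈ vbar.asIdeal) {Ω δ : ℂ} {Ωp : ℂ_[p]}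
    {S : Finset (HeightOneSpectrum (𝓞 K))}
    (hex : ∃ (𝒰 : SubgroupTower (absoluteGaloisGroup K)) (μ : GroupDistribution 𝒰 ℂ_[p]),
      (∀ n, IsOpen (𝒰.U n : Set (absoluteGaloisGroup K))) ∧
      (⋂ n, (𝒰.U n : Set (absoluteGaloisGroup K))) ⊆ DeShalit1987.rayKer K p S ∧
      μ.bound ≤ 1 ∧ DeShalit1987.IsLMeasure ι v vbar S Ω δ Ωp 𝒰 μ)
    {lam : HeckeCharacter K} (hlam : lam.IsAlgebraic)
    (hunr : ∀ w : HeightOneSpectrum (𝓞 K), w ∉ S → w ≠ v → w ≠ vbar → lam.IsUnramifiedAt w)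
    {κ₁ κ₂ : ZpExtension K p} (hind : κ₁.IsIndependent κ₂) :
    ∃ D : BoundedDistribution (padicIntSq p) ℂ_[p], D.bound ≤ 1 ∧
      DeShalit1987.IsKatzDistribution₂ ι v vbar S κ₁ κ₂ lam Ω δ Ωp D := by
  -- Weil's avatar of `λ`, in `IsPAdicAvatarOf` form
  obtain ⟨l, hl⟩ := hlam.exists_lAdic ι
  have hl' : IsPAdicAvatarOf ι lam l := fun w hw hu ↦ by
    refine ⟨(hl w hw hu).1, ?_⟩
    have h := (hl w hw hu).2
    rwa [map_inv₀] at h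
  exact DeShalit1987.exists_isKatzDistribution₂_of_isLMeasure hv hvbar hex (hl'.isPAdicAvatarOutside S)
    hunr hind

/-- **At a fixed prime: the measure-currency statement implies the distribution-currency statement**
(hypothesis `hμ` of the crux files `…TwoVariableMainConjAtSplitTwo(Quad)MeasureFromDistribution` of
`Summits/BirchSwinnertonDyer` at `p = 2`; the right-hand side of
`thmII417_exists_katzSheet_iff_exists_katzDistribution₂` at `p`). [cite: deShalit1987, II Thm. 4.14 (p. 71), II.4.16 (49)–(50) (p. 76–77), II.4.17 (54) (p. 78)] -/
theorem DeShalit1987.katzDistributions₂_of_lMeasures (p : ℕ) [Fact p.Prime]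
    (hν : ∀ (K : Type) [Field K] [NumberField K], IsImaginaryQuadratic K →
      ∀ (ι : PadicAlgCl p ≃+* ℂ) (v vbar : HeightOneSpectrum (𝓞 K)),
        ((p : ℕ) : 𝓞 K) ∈ v.asIdeal → ((p : ℕ) : 𝓞 K) ∈ vbar.asIdeal → vbar ≠ v →
        (∀ (w : InfinitePlace K) (k : 𝓞 K), k ∈ v.asIdeal ↔ ‖ι.symm (w.embedding (k : K))‖ < 1) →
      ∃ (Ω δ : ℂ) (Ωp : (unrIntegers p)ˣ), Ω ≠ 0 ∧
        (δ ^ 2 = (NumberField.discr K : ℂ) ∨ δ ^ 2 = -(NumberField.discr K : ℂ)) ∧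
        ∀ (S : Finset (HeightOneSpectrum (𝓞 K))), v ∉ S → vbar ∉ S →
          ∃ (𝒰 : SubgroupTower (absoluteGaloisGroup K)) (μ : GroupDistribution 𝒰 ℂ_[p]),
            (∀ n, IsOpen (𝒰.U n : Set (absoluteGaloisGroup K))) ∧
            (⋂ n, (𝒰.U n : Set (absoluteGaloisGroup K))) ⊆ DeShalit1987.rayKer K p S ∧
            μ.bound ≤ 1 ∧
            DeShalit1987.IsLMeasure ι v vbar S Ω δ ((Ωp : unrIntegers p) : ℂ_[p]) 𝒰 μ) :
    ∀ (K : Type) [Field K] [NumberField K], IsImaginaryQuadratic K →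
      ∀ (ι : PadicAlgCl p ≃+* ℂ) (v vbar : HeightOneSpectrum (𝓞 K)),
        ((p : ℕ) : 𝓞 K) ∈ v.asIdeal → ((p : ℕ) : 𝓞 K) ∈ vbar.asIdeal → vbar ≠ v →
        (∀ (w : InfinitePlace K) (k : 𝓞 K), k ∈ v.asIdeal ↔ ‖ι.symm (w.embedding (k : K))‖ < 1) →
      ∃ (Ω δ : ℂ) (Ωp : (unrIntegers p)ˣ), Ω ≠ 0 ∧
        (δ ^ 2 = (NumberField.discr K : ℂ) ∨ δ ^ 2 = -(NumberField.discr K : ℂ)) ∧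
        ∀ (S : Finset (HeightOneSpectrum (𝓞 K))), v ∉ S → vbar ∉ S →
        ∀ (lam : HeckeCharacter K), lam.IsAlgebraic →
          (∀ w : HeightOneSpectrum (𝓞 K), w ∉ S → w ≠ v → w ≠ vbar → lam.IsUnramifiedAt w) →
        ∀ (κ₁ κ₂ : ZpExtension K p), κ₁.IsIndependent κ₂ →
          ∃ D : BoundedDistribution (padicIntSq p) ℂ_[p], D.bound ≤ 1 ∧
            DeShalit1987.IsKatzDistribution₂ ι v vbar S κ₁ κ₂ lam Ω δ ((Ωp : unrIntegers p) : ℂ_[p]) D := by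
  intro K _ _ hK ι v vbar hv hvbar hne hι
  obtain ⟨Ω, δ, Ωp, hΩ, hδ, hall⟩ := hν K hK ι v vbar hv hvbar hne hι
  refine ⟨Ω, δ, Ωp, hΩ, hδ, ?_⟩
  intro S hvS hvbarS lam hlam hunr κ₁ κ₂ hind
  exact DeShalit1987.exists_isKatzDistribution₂_of_isLMeasure_of_isAlgebraic hv hvbar (hall S hvS hvbarS)
    hlam hunr hind

end Literature.NumberTheory.EllipticCurves

end
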